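import Literature.AlgebraicGeometry.Resolution.DefectTransport
import Literature.AlgebraicGeometry.Resolution.ValuationDefectProofs
import Literature.AlgebraicGeometry.Resolution.NormalizationOfVarietiesProofs
import Literature.AlgebraicGeometry.Resolution.GeneralizedStabilityFiniteRankLemmas
import Mathlib.NumberTheory.RamificationInertia.Basic
import Mathlib.NumberTheory.RamificationInertia.Valuation
import Mathlib.RingTheory.DedekindDomain.AdicValuation
import Mathlib.RingTheory.DedekindDomain.SelmerGroup
import Mathlib.RingTheory.Localization.AtPrime.Basic
import Mathlib.Data.ZMod.QuotientGroup
import HarnessLib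

/-!
# Dedekind domains with finite integral closure are defectless; `K(t)` over a trivially valued `K`

Topic: `Literature/AlgebraicGeometry/Resolution` (valued function fields). Everything here is
PROVED and there are no new definitions. The file links the valuation-theoretic invariants
`e = (vL : vK)`, `f = [Lv : Kv]` and "defectless" of `ValuationDefect.lean` (Kuhlmann 2010,
§1; Temkin 2013, §2.1) with Mathlib's ramification theory of Dedekind domains
(`Ideal.ramificationIdx'`, `Ideal.inertiaDeg'`, `Ideal.sum_ramification_inertia`,
`IsDedekindDomain.HeightOneSpectrum.valuation` / `valuationSubringAtPrime` /
`valuationOfNeZero`, `IsLocalization.AtPrime.equivQuotMaximalIdeal`), and draws the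
consequence needed one layer below the named fact `Kuhlmann2010StabilityAlgClosedFiniteRank`
(`GeneralizedStabilityFiniteRank.lean` = F.-V. Kuhlmann, *Elimination of ramification I*,
Trans. AMS 362 (2010) = arXiv:1003.5678, §5, (R3)/(R4) for `F = K(t)`): in the reduction of
(R3) to rank one (Lemma 5.4: `v = w₁ ∘ … ∘ w_n`, Lemmas 2.8 and 2.17;
`GeneralizedStabilityRankOneProofs.lean`) the rank-one pieces `(K(t), w)` and `(Kw(t̄), w̄)`
include those whose restriction to the (algebraically closed) constant field is TRIVIAL — the
`t`-adic and `1/t`-adic valuations of a rational function field —, and for these (R4)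
(`Kuhlmann2010StabilityRankOneValueTranscendental`, `GeneralizedStabilityRankOne.lean`) is the
classical fact proved here (`isDefectlessField_of_valueTranscendental_of_comap_eq_top`): **a
rational function field `K(t)` is a defectless field under every valuation that is trivial on
`K`**, for an arbitrary field `K`.

## The argument [folklore]

Let `A` be a Dedekind domain with fraction field `F`, `𝔭 ≠ 0` a prime, `A_𝔭 ⊆ F` its valuation
ring (Mathlib's `valuationSubringAtPrime F 𝔭`), and `L/F` finite such that the integral closure
`B` of `A` in `L` is a finite `A`-module (e.g. `L/F` separable — Mathlib's
`IsIntegralClosure.finite` —, or `A` of finite type over a field — E. Noether,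
`NoetherFiniteIntegralClosure_holds`, `NormalizationOfVarietiesProofs.lean`). Then `B` is a
Dedekind domain with `Frac B = L`, and:

* the extensions of `A_𝔭` to `L` (valuation rings `O'` of `L` with `O' ∩ F = A_𝔭`) are exactly
  the `B_𝔓`, `𝔓 | 𝔭` (`comap_valuationSubringAtPrime`, `exists_eq_valuationSubringAtPrime`:
  `O' ⊇ B` by integral closedness, the centre `𝔪_{O'} ∩ B = 𝔓` lies over `𝔭`, `B_𝔓 ⊆ O'`, and
  `B_𝔓` is a maximal proper subring — Mathlib's `ValuationSubring.eq_of_le_of_ne_top`), with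
  `𝔓 ↦ B_𝔓` injective (`valuationSubringAtPrime_injective`);
* `e(B_𝔓/F) = e(𝔓|𝔭)` (`ramificationIndex_valuationSubringAtPrime`: `e = [L^× : F^× B_𝔓^×]`
  (`ramificationIndex_eq_index`, `DefectlessComposite.lean`) is computed through
  `ord_𝔓 : L^× ↠ ℤ` (Mathlib's `valuationOfNeZero`; onto, `valuationOfNeZero_surjective`,
  with kernel `B_𝔓^×`, `valuationOfNeZero_eq_one_iff`), under which `F^×` has image
  `e(𝔓|𝔭)ℤ` by Mathlib's `valuation_liesOver : v_𝔭(x)^e = v_𝔓(x)` (`valuationOfNeZero_map`));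
* `f(B_𝔓/F) = f(𝔓|𝔭)` (`inertiaDegree_valuationSubringAtPrime`, through Mathlib's
  `κ(A_𝔭) ≅ A/𝔭`, `κ(B_𝔓) ≅ B/𝔓` = `IsLocalization.AtPrime.equivQuotMaximalIdeal`);
* hence `∑_{O'} e f = ∑_{𝔓|𝔭} e(𝔓|𝔭) f(𝔓|𝔭) = [L : F]` (`Ideal.sum_ramification_inertia`):
  `(F, A_𝔭)` is defectless in `L` (`isDefectlessIn_valuationSubringAtPrime`,
  `isDefectlessIn_of_finite_integralClosure`).

For `A` a Dedekind domain of finite type over a field `k`, Noether's finiteness gives this in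
every finite `L`, so `(F, A_𝔭)` is a defectless field
(`isDefectlessField_valuationSubringAtPrime`), and so is `(F, O)` for every valuation ring
`O ⊇ A` of `F` (`isDefectlessField_of_algebraMap_mem`: `O = F`, trivially valued hence
defectless — `isDefectlessField_top`, `ValuationDefectProofs.lean` —, or `O = A_𝔭` for the
centre `𝔭`, `exists_eq_valuationSubringAtPrime_of_le`). With `A = K[t]` or `K[1/t]`:
`isDefectlessField_of_transcendental_of_adjoin_eq_top` (`F = K(t)`, `t` transcendental,
`K ⊆ O`) and `isDefectlessField_of_valueTranscendental_of_comap_eq_top` (the hypotheses of the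
(R3)/(R4) facts: `t` value-transcendental — hence transcendental,
`transcendental_of_valueTranscendental` — and `O ∩ K = K`).

## Main results (all PROVED)

* `exists_eq_valuationSubringAtPrime_of_le` — the valuation rings `≠ F` of `Frac A` containing
  a Dedekind domain `A` are the `A_𝔭`.
* `isDefectlessIn_valuationSubringAtPrime`, `isDefectlessIn_of_finite_integralClosure` — the
  Dedekind criterion above; `ramificationIndex_valuationSubringAtPrime`,
  `inertiaDegree_valuationSubringAtPrime`, `comap_valuationSubringAtPrime`,
  `exists_eq_valuationSubringAtPrime` — the dictionary with Mathlib's `e(𝔓|𝔭)`, `f(𝔓|𝔭)`.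
* `isDefectlessField_valuationSubringAtPrime`, `isDefectlessField_of_algebraMap_mem` — Dedekind
  domains of finite type over a field.
* `isDefectlessField_of_transcendental_of_adjoin_eq_top`,
  `isDefectlessField_of_valueTranscendental_of_comap_eq_top` — `K(t)` with a valuation trivial on
  `K` is a defectless field (the sub-case "`v|K` trivial" of (R4) for `K(t)`, Kuhlmann 2010, §5).

## Relation to the tree and to Mathlib (search before re-proving)

* Mathlib survivors used here: `valuationSubringAtPrime` (= `(valuation F v).valuationSubring`,
  `valuationSubringAtPrime_eq_valuationSubring`, with its `Ring.KrullDimLE 1` and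
  `IsLocalization.AtPrime` instances), `IsLocalization.AtPrime.equivQuotMaximalIdeal`
  (`A ⧸ 𝔭 ≃+* κ(A_𝔭)`), `valuationOfNeZero : F^× →* Multiplicative ℤ` (`SelmerGroup.lean`),
  `valuation_liesOver` (`RamificationInertia/Valuation.lean`), `Ideal.sum_ramification_inertia`.
* `NumberTheory/EllipticCurves/FunctionFieldPlacesProductFormulaProofs.lean` carries a
  `Place`-bound, universe-`Type` version of the same dictionary for function fields
  (`val_eq_valuationSubringAtPrime_comap` ≈ `exists_eq_valuationSubringAtPrime_of_le`,
  `exists_residueField_equiv_quotient`, a `∑ e f` glue); the general `ValuationSubring` /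
  `Type u` statements below are the intended survivors on which those can be re-based.
* `ValuationRingOpenInNormalizationProofs.lean` (Bourbaki VI §8 Prop. 6: the valuation rings of
  a finite extension over `k°` are the localizations of the integral closure) is the analogue
  for an arbitrary valuation ring `k°` in place of `A_𝔭`; no declaration is shared.

## Sources

* F.-V. Kuhlmann, *Elimination of ramification I: The generalized stability theorem*, Trans.
  AMS 362 (2010) 5697–5727 = arXiv:1003.5678: §1 p. 3 (fundamental inequality, defectless
  fields; "every trivially valued field is a defectless field"), §5 Lemma 5.4 and (R4) (p. 18).
* J. Neukirch, *Algebraic Number Theory*, Ch. I §8 (the fundamental identity `∑ eᵢ fᵢ = n` for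
  Dedekind domains with finite integral closure; Mathlib `Ideal.sum_ramification_inertia`) and
  Ch. II §8 (extensions of valuations of `Frac A` ↔ primes of the integral closure). [folklore]
* Q. Liu, *Algebraic Geometry and Arithmetic Curves*, Prop. 4.1.27 (E. Noether's finiteness of
  the integral closure; `NoetherFiniteIntegralClosure_holds`).

## Rendering notes

* As in `ValuationDefect.lean`, an extension of valued fields is `[Algebra F L]` with a valuation
  ring `O'` of `L`, the valuation ring of `F` being `O'.comap (algebraMap F L)`; `A_𝔭` is Mathlib's
  `valuationSubringAtPrime F v` for `v : HeightOneSpectrum A` (membership = `v(x) ≤ 1`,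
  `mem_valuationSubringAtPrime_iff`, after `valuationSubringAtPrime_eq_valuationSubring`).
* `A ⊆ B` is `[Algebra A B] [IsScalarTower A B L]` with `[Module.IsTorsionFree A B]` (Mathlib's
  hypothesis in `valuation_liesOver`); for `B = integralClosure A L` these hold.
* The local instances `comapAlgebra`, `isLocalHom_algebraMap_comap` (tree-owned,
  `DefectlessComposite.lean`) are used exactly as there, for `finrank_residueField`.
-/

noncomputable section

open IsLocalRing IsDedekindDomain IsDedekindDomain.HeightOneSpectrum

namespace Literature.AlgebraicGeometry.Resolution

universe u

section DVR

variable {A F : Type u} [CommRing A] [IsDedekindDomain A] [Field F] [Algebra A F]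
  [IsFractionRing A F]

/-- Membership in `A_𝔭 ⊆ Frac A`: `x ∈ A_𝔭 ↔ v_𝔭(x) ≤ 1`. [folklore] -/
theorem mem_valuationSubringAtPrime_iff (v : HeightOneSpectrum A) (x : F) :
    x ∈ valuationSubringAtPrime F v ↔ valuation F v x ≤ 1 := by
  rw [valuationSubringAtPrime_eq_valuationSubring]
  rfl

/-- `A_𝔭 ≠ Frac A` (`v_𝔭` is non-trivial). [folklore] -/
theorem valuationSubringAtPrime_ne_top (v : HeightOneSpectrum A) :
    valuationSubringAtPrime F v ≠ ⊤ := by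
  rw [valuationSubringAtPrime_eq_valuationSubring, Ne, Valuation.valuationSubring_eq_top_iff,
    not_not]
  infer_instance

/-- `𝔭 ↦ A_𝔭` is injective. [folklore] -/
theorem valuationSubringAtPrime_injective :
    Function.Injective fun v : HeightOneSpectrum A => valuationSubringAtPrime F v := by
  intro v₁ v₂ h
  simp only [valuationSubringAtPrime_eq_valuationSubring] at h
  exact eq_of_valuation_isEquiv_valuation ((Valuation.isEquiv_iff_valuationSubring _ _).mpr h)

/-- The units of `A_𝔭` are the elements of `v_𝔭`-value `1`. [folklore] -/
theorem mem_unitGroup_valuationSubringAtPrime_iff (v : HeightOneSpectrum A) (x : Fˣ) :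
    x ∈ (valuationSubringAtPrime F v).unitGroup ↔ valuation F v x = 1 := by
  rw [valuationSubringAtPrime_eq_valuationSubring, Valuation.mem_unitGroup_iff]

/-- `a ∈ A` lies in the maximal ideal of `A_𝔭` iff `a ∈ 𝔭`. [folklore] -/
theorem algebraMap_mem_maximalIdeal_valuationSubringAtPrime_iff (v : HeightOneSpectrum A) (a : A) :
    algebraMap A (valuationSubringAtPrime F v) a ∈ maximalIdeal _ ↔ a ∈ v.asIdeal := by
  rw [← Ideal.mem_comap, ← Ideal.under_def,
    IsLocalization.AtPrime.under_maximalIdeal (valuationSubringAtPrime F v) v.asIdeal]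

/-- For `x ∈ F` and a valuation ring `O'` of an extension `L` lying over `A_𝔭`:
`x ∈ 𝔪_{O'}` iff `v_𝔭(x) < 1`. [folklore] -/
theorem valuation_algebraMap_lt_one_iff_of_comap_eq_valuationSubringAtPrime {L : Type u} [Field L]
    [Algebra F L] (v : HeightOneSpectrum A) (O' : ValuationSubring L)
    (hO' : O'.comap (algebraMap F L) = valuationSubringAtPrime F v) (x : F) :
    O'.valuation (algebraMap F L x) < 1 ↔ valuation F v x < 1 := by
  by_cases hx : x = 0
  · simp [hx]
  have hxL : algebraMap F L x ≠ 0 := (map_ne_zero _).mpr hx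
  have key : (algebraMap F L x)⁻¹ ∈ O' ↔ (valuation F v x)⁻¹ ≤ 1 := by
    rw [← map_inv₀, ← ValuationSubring.mem_comap, hO', mem_valuationSubringAtPrime_iff, map_inv₀]
  rw [← O'.valuation_le_one_iff, map_inv₀,
    inv_le_one₀ (zero_lt_iff.mpr ((map_ne_zero _).mpr hxL)),
    inv_le_one₀ (zero_lt_iff.mpr ((map_ne_zero _).mpr hx))] at key
  rw [← not_le, key, not_le]

/-! #### The order homomorphism `ord_𝔭 : F^× → ℤ` (Mathlib's `valuationOfNeZero`) -/

/-- `ord_𝔭 : F^× → ℤ` is onto (a uniformizer has order `1`). [folklore] -/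
theorem valuationOfNeZero_surjective (v : HeightOneSpectrum A) :
    Function.Surjective (v.valuationOfNeZero (K := F)) := by
  intro m
  obtain ⟨x, hx⟩ := valuation_surjective (K := F) v (m : WithZero (Multiplicative ℤ))
  have hx0 : x ≠ 0 := by
    intro h
    rw [h, map_zero] at hx
    exact WithZero.coe_ne_zero hx.symm
  refine ⟨Units.mk0 x hx0, ?_⟩
  apply WithZero.coe_inj.mp
  rw [valuationOfNeZero_eq, Units.val_mk0, hx]

/-- The kernel of `ord_𝔭` consists of the elements of value `1`. [folklore] -/
theorem valuationOfNeZero_eq_one_iff (v : HeightOneSpectrum A) (x : Fˣ) :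
    v.valuationOfNeZero (K := F) x = 1 ↔ valuation F v x = 1 := by
  rw [← WithZero.coe_inj, valuationOfNeZero_eq, WithZero.coe_one]

end DVR

section Dedekind

variable {A F B L : Type u} [CommRing A] [IsDedekindDomain A] [Field F] [Algebra A F]
  [IsFractionRing A F] [CommRing B] [IsDedekindDomain B] [Field L] [Algebra B L]
  [IsFractionRing B L]
  [Algebra A B] [Algebra F L] [Algebra A L] [IsScalarTower A F L]
  [IsScalarTower A B L]

include F L in
omit [IsDedekindDomain A] [IsDedekindDomain B] [IsFractionRing B L] in
/-- `A → B` is injective (both embed compatibly in `L ⊇ F = Frac A`). [folklore] -/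
theorem algebraMap_injective_of_tower : Function.Injective (algebraMap A B) := fun a b h => by
  apply IsFractionRing.injective A F
  apply (algebraMap F L).injective
  rw [← IsScalarTower.algebraMap_apply, ← IsScalarTower.algebraMap_apply,
    IsScalarTower.algebraMap_apply A B L, h, ← IsScalarTower.algebraMap_apply]

variable [Module.IsTorsionFree A B]

/-- **`B_𝔓` restricts to `A_𝔭` on `F`** when `𝔓` lies over `𝔭` (`v_𝔓 = v_𝔭 ^ e` on `F`,
Mathlib's `valuation_liesOver`). [folklore] -/
theorem comap_valuationSubringAtPrime (v : HeightOneSpectrum A) (w : HeightOneSpectrum B)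
    [w.asIdeal.LiesOver v.asIdeal] :
    (valuationSubringAtPrime L w).comap (algebraMap F L) = valuationSubringAtPrime F v := by
  ext x
  rw [ValuationSubring.mem_comap, mem_valuationSubringAtPrime_iff,
    mem_valuationSubringAtPrime_iff, ← valuation_liesOver L v w x]
  exact pow_le_one_iff
    (Ideal.IsDedekindDomain.ramificationIdx'_ne_zero_of_liesOver w.asIdeal v.ne_bot)

/-- `ord_𝔓 = e(𝔓|𝔭) · ord_𝔭` on `F^×`. [folklore] -/
theorem valuationOfNeZero_map (v : HeightOneSpectrum A) (w : HeightOneSpectrum B)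
    [w.asIdeal.LiesOver v.asIdeal] (x : Fˣ) :
    w.valuationOfNeZero (K := L) (Units.map (algebraMap F L : F →* L) x) =
      v.valuationOfNeZero (K := F) x ^ v.asIdeal.ramificationIdx' w.asIdeal := by
  apply WithZero.coe_inj.mp
  rw [valuationOfNeZero_eq, Units.coe_map, MonoidHom.coe_coe, ← valuation_liesOver L v w,
    WithZero.coe_pow, valuationOfNeZero_eq]

variable [Algebra.IsIntegral A B]

omit [IsDedekindDomain B] [IsFractionRing B L] [Module.IsTorsionFree A B] in
/-- A valuation ring of `L` lying over `A_𝔭` contains `B` (`B` is integral over `A`, and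
valuation rings are integrally closed). [folklore] -/
theorem algebraMap_mem_of_comap_eq_valuationSubringAtPrime (v : HeightOneSpectrum A)
    (O' : ValuationSubring L) (hO' : O'.comap (algebraMap F L) = valuationSubringAtPrime F v)
    (b : B) : algebraMap B L b ∈ O' := by
  have hA : ∀ a : A, algebraMap A L a ∈ O' := fun a => by
    have : algebraMap A F a ∈ valuationSubringAtPrime F v :=
      (mem_valuationSubringAtPrime_iff v _).mpr (valuation_le_one v a)
    rw [← hO', ValuationSubring.mem_comap, ← IsScalarTower.algebraMap_apply] at this
    exact this
  let ι : A →+* O' := (algebraMap A L).codRestrict O'.toSubring hA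
  letI : Algebra A O' := ι.toAlgebra
  haveI : IsScalarTower A O' L := IsScalarTower.of_algebraMap_eq fun a => rfl
  have hint : IsIntegral O' (algebraMap B L b) :=
    IsIntegral.tower_top (A := O') ((Algebra.IsIntegral.isIntegral (R := A) b).algebraMap)
  obtain ⟨y, hy⟩ := (IsIntegralClosure.isIntegral_iff (A := O') (R := O') (B := L)).mp hint
  rw [← hy]
  exact y.2

omit [Module.IsTorsionFree A B] in
/-- **Every valuation ring of `L = Frac B` over `A_𝔭` is a `B_𝔓` with `𝔓` over `𝔭`**: its
centre on `B` is a non-zero prime `𝔓` over `𝔭`, `B_𝔓 ⊆ O'`, and `B_𝔓` is a maximal proper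
subring of `L`. [folklore] -/
theorem exists_eq_valuationSubringAtPrime (v : HeightOneSpectrum A) (O' : ValuationSubring L)
    (hO' : O'.comap (algebraMap F L) = valuationSubringAtPrime F v) :
    ∃ w : HeightOneSpectrum B, w.asIdeal.LiesOver v.asIdeal ∧
      valuationSubringAtPrime L w = O' := by
  have hB : ∀ b : B, algebraMap B L b ∈ O' :=
    algebraMap_mem_of_comap_eq_valuationSubringAtPrime v O' hO'
  let ι : B →+* O' := (algebraMap B L).codRestrict O'.toSubring hB
  let Q : Ideal B := (maximalIdeal O').comap ι
  haveI hQ : Q.IsPrime := Ideal.comap_isPrime ι _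
  have hmemQ : ∀ b : B, b ∈ Q ↔ O'.valuation (algebraMap B L b) < 1 := fun b => by
    change ι b ∈ maximalIdeal O' ↔ _
    rw [ValuationSubring.valuation_lt_one_iff]
    rfl
  -- membership in `Q` for elements of `A`
  have hmemA : ∀ a : A, algebraMap A B a ∈ Q ↔ a ∈ v.asIdeal := fun a => by
    rw [hmemQ, ← IsScalarTower.algebraMap_apply, IsScalarTower.algebraMap_apply A F L,
      valuation_algebraMap_lt_one_iff_of_comap_eq_valuationSubringAtPrime v O' hO',
      valuation_lt_one_iff_mem]
  -- `Q ≠ ⊥`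
  have hQ0 : Q ≠ ⊥ := by
    obtain ⟨a, ha, ha0⟩ := Submodule.exists_mem_ne_zero_of_ne_bot v.ne_bot
    intro hQ0
    have : algebraMap A B a ∈ Q := (hmemA a).mpr ha
    rw [hQ0, Ideal.mem_bot, map_eq_zero_iff _ (algebraMap_injective_of_tower (F := F) (L := L))]
      at this
    exact ha0 this
  let w : HeightOneSpectrum B := ⟨Q, hQ, hQ0⟩
  have hlies : w.asIdeal.LiesOver v.asIdeal := ⟨Ideal.ext fun a => by
    rw [Ideal.under_def, Ideal.mem_comap]
    exact (hmemA a).symm⟩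
  refine ⟨w, hlies, ?_⟩
  -- `B_Q ≤ O'`
  have hle : valuationSubringAtPrime L w ≤ O' := by
    intro x hx
    rw [mem_valuationSubringAtPrime_iff] at hx
    obtain ⟨n, d, hnd⟩ := exists_primeCompl_mul_eq_of_integer w x hx
    have hd : O'.valuation (algebraMap B L d) = 1 := by
      have h1 : ¬O'.valuation (algebraMap B L d) < 1 := fun h => d.2 ((hmemQ d).mpr h)
      exact le_antisymm ((O'.valuation_le_one_iff _).mpr (hB d)) (not_lt.mp h1)
    have hd0 : algebraMap B L d ≠ 0 := fun h => by
      rw [h, map_zero] at hd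
      exact zero_ne_one hd
    have hx' : x = algebraMap B L n * (algebraMap B L d)⁻¹ := by
      rw [← hnd, mul_inv_cancel_right₀ hd0]
    rw [hx']
    refine mul_mem (hB n) ?_
    rw [← O'.valuation_le_one_iff, map_inv₀, hd, inv_one]
  -- `O' ≠ ⊤`
  have hne : O' ≠ ⊤ := by
    intro h
    apply valuationSubringAtPrime_ne_top (F := F) v
    rw [← hO', h]
    ext x
    simp [ValuationSubring.mem_comap, ValuationSubring.mem_top]
  exact ValuationSubring.eq_of_le_of_ne_top _ hle hne

end Dedekind

section RamificationIndex

variable {A F B L : Type u} [CommRing A] [IsDedekindDomain A] [Field F] [Algebra A F]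
  [IsFractionRing A F] [CommRing B] [IsDedekindDomain B] [Field L] [Algebra B L]
  [IsFractionRing B L] [Algebra A B] [Algebra F L] [Algebra A L] [IsScalarTower A F L]
  [IsScalarTower A B L] [Module.IsTorsionFree A B]

/-- **`e(B_𝔓 / F) = e(𝔓|𝔭)`**: the ramification index of the extension of valued fields
`(L, B_𝔓)/(F, A_𝔭)` (`ramificationIndex`, the index `(v_𝔓 L^× : v_𝔓 F^×)`) is the
Dedekind ramification index of `𝔓` over `𝔭`: through `ord_𝔓 : L^× ↠ ℤ` (kernel `B_𝔓^×`,
`ord_𝔓(F^×) = e(𝔓|𝔭)ℤ`) one has `[L^× : F^× B_𝔓^×] = [ℤ : eℤ] = e`. [folklore] -/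
theorem ramificationIndex_valuationSubringAtPrime (v : HeightOneSpectrum A)
    (w : HeightOneSpectrum B) [w.asIdeal.LiesOver v.asIdeal] :
    ramificationIndex F (valuationSubringAtPrime L w) =
      v.asIdeal.ramificationIdx' w.asIdeal := by
  classical
  set e := v.asIdeal.ramificationIdx' w.asIdeal with he_def
  let θ := w.valuationOfNeZero (K := L)
  have hH : unitsSup F (valuationSubringAtPrime L w) =
      (AddSubgroup.toSubgroup (AddSubgroup.zmultiples (e : ℤ))).comap θ := by
    apply le_antisymm
    · refine sup_le ?_ ?_
      · rintro _ ⟨x, rfl⟩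
        rw [Subgroup.mem_comap, Multiplicative.mem_toSubgroup, valuationOfNeZero_map v w,
          toAdd_pow, AddSubgroup.mem_zmultiples_iff]
        exact ⟨Multiplicative.toAdd (v.valuationOfNeZero (K := F) x), by
          rw [smul_eq_mul, nsmul_eq_mul, mul_comm]⟩
      · intro x hx
        rw [mem_unitGroup_valuationSubringAtPrime_iff, ← valuationOfNeZero_eq_one_iff] at hx
        rw [Subgroup.mem_comap, hx]
        exact one_mem _
    · intro x hx
      rw [Subgroup.mem_comap, Multiplicative.mem_toSubgroup, AddSubgroup.mem_zmultiples_iff] at hx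
      obtain ⟨k, hk⟩ := hx
      -- an element of `F^×` of order `k`
      obtain ⟨y, hy⟩ := valuationOfNeZero_surjective (F := F) v (Multiplicative.ofAdd k)
      let yu : Lˣ := Units.map (algebraMap F L : F →* L) y
      have hθy : θ yu = θ x := by
        apply Multiplicative.toAdd.injective
        change Multiplicative.toAdd (w.valuationOfNeZero (K := L) yu) = _
        rw [valuationOfNeZero_map v w, hy, toAdd_pow, toAdd_ofAdd, ← hk, smul_eq_mul,
          nsmul_eq_mul, mul_comm]
      have hmem : yu⁻¹ * x ∈ (valuationSubringAtPrime L w).unitGroup := by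
        rw [mem_unitGroup_valuationSubringAtPrime_iff, ← valuationOfNeZero_eq_one_iff, map_mul,
          map_inv]
        change (θ yu)⁻¹ * θ x = 1
        rw [hθy, inv_mul_cancel]
      have : x = yu * (yu⁻¹ * x) := by group
      rw [this]
      exact Subgroup.mul_mem_sup ⟨y, rfl⟩ hmem
  rw [ramificationIndex_eq_index, hH, Subgroup.index_comap_of_surjective _
    (valuationOfNeZero_surjective (F := L) w), AddSubgroup.index_toSubgroup, Int.index_zmultiples,
    Int.natAbs_natCast]

end RamificationIndex

section InertiaDegree

variable {A F B L : Type u} [CommRing A] [IsDedekindDomain A] [Field F] [Algebra A F]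
  [IsFractionRing A F] [CommRing B] [IsDedekindDomain B] [Field L] [Algebra B L]
  [IsFractionRing B L] [Algebra A B] [Algebra F L] [Algebra A L] [IsScalarTower A F L]
  [IsScalarTower A B L] [Module.IsTorsionFree A B]

attribute [local instance] comapAlgebra isLocalHom_algebraMap_comap

/-- **`f(B_𝔓 / F) = f(𝔓|𝔭)`**: the inertia degree of the extension of valued fields
`(L, B_𝔓)/(F, A_𝔭)` (`inertiaDegree`, `[κ(B_𝔓) : κ(A_𝔭)]`) is the Dedekind inertia degree
`[B/𝔓 : A/𝔭]`, through Mathlib's `κ(A_𝔭) ≅ A/𝔭`, `κ(B_𝔓) ≅ B/𝔓`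
(`IsLocalization.AtPrime.equivQuotMaximalIdeal`). [folklore] -/
theorem inertiaDegree_valuationSubringAtPrime (v : HeightOneSpectrum A) (w : HeightOneSpectrum B)
    [w.asIdeal.LiesOver v.asIdeal] :
    inertiaDegree F (valuationSubringAtPrime L w) = v.asIdeal.inertiaDeg' w.asIdeal := by
  set W := valuationSubringAtPrime L w with hW
  have hc : W.comap (algebraMap F L) = valuationSubringAtPrime F v :=
    comap_valuationSubringAtPrime v w
  -- `κ(A_𝔭) ≅ κ(W ∩ F)` along the equality `W ∩ F = A_𝔭`
  let ε : valuationSubringAtPrime F v ≃+* W.comap (algebraMap F L) :=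
    RingEquiv.subringCongr (by rw [hc])
  let i : A ⧸ v.asIdeal ≃+* ResidueField (W.comap (algebraMap F L)) :=
    (IsLocalization.AtPrime.equivQuotMaximalIdeal v.asIdeal (valuationSubringAtPrime F v)).trans
      (ResidueField.mapEquiv ε)
  let j : B ⧸ w.asIdeal ≃+* ResidueField W :=
    IsLocalization.AtPrime.equivQuotMaximalIdeal w.asIdeal W
  rw [Ideal.inertiaDeg'_algebraMap, ← finrank_residueField F W]
  refine (Algebra.finrank_eq_of_equiv_equiv i j ?_).symm
  refine Ideal.Quotient.ringHom_ext (RingHom.ext fun a => ?_)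
  have h1 : i (Ideal.Quotient.mk v.asIdeal a) =
      residue _ (ε (algebraMap A (valuationSubringAtPrime F v) a)) := rfl
  have h2 : j (Ideal.Quotient.mk w.asIdeal (algebraMap A B a)) =
      residue W (algebraMap B W (algebraMap A B a)) :=
    IsLocalization.AtPrime.equivQuotMaximalIdeal_apply_mk _ _ _
  simp only [RingHom.comp_apply, RingEquiv.toRingHom_eq_coe, RingHom.coe_coe]
  rw [Ideal.Quotient.algebraMap_mk_of_liesOver, algebraMap_residueField_eq, h1, h2,
    residueFieldHom_residue]
  congr 1
  apply Subtype.ext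
  rw [coe_comapSubringHom_apply]
  change algebraMap F L (algebraMap A F a) = algebraMap B L (algebraMap A B a)
  rw [← IsScalarTower.algebraMap_apply, ← IsScalarTower.algebraMap_apply]

end InertiaDegree


section Main

variable {A F : Type u} [CommRing A] [IsDedekindDomain A] [Field F] [Algebra A F]
  [IsFractionRing A F] (B : Type u) {L : Type u} [CommRing B] [IsDedekindDomain B] [Field L]
  [Algebra B L] [IsFractionRing B L] [Algebra A B] [Algebra F L] [Algebra A L]
  [IsScalarTower A F L] [IsScalarTower A B L] [Module.IsTorsionFree A B] [Module.Finite A B]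

include B in
/-- **The fundamental equality `∑ eᵢ fᵢ = n` for `A_𝔭` when the integral closure is finite.**
Let `A ⊆ B` be Dedekind domains with fraction fields `F ⊆ L`, `B` a finite `A`-module (so
`[L : F] < ∞` and `B` is the integral closure of `A` in `L`), and `𝔭` a non-zero prime of `A`.
Then the valued field `(F, A_𝔭)` is defectless in `L`: its extensions to `L` are exactly the
`B_𝔓`, `𝔓 | 𝔭`, and `∑_𝔓 e(𝔓|𝔭) f(𝔓|𝔭) = [L : F]` (Mathlib's `Ideal.sum_ramification_inertia`).
[folklore] -/
theorem isDefectlessIn_valuationSubringAtPrime (v : HeightOneSpectrum A) :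
    IsDefectlessIn F (valuationSubringAtPrime F v) L := by
  classical
  haveI : Algebra.IsIntegral A B := Algebra.IsIntegral.of_finite A B
  -- the primes over `𝔭`, as points of the height-one spectrum of `B`
  let s := IsDedekindDomain.primesOverFinset v.asIdeal B
  have hmem : ∀ P ∈ s, P.IsPrime ∧ P.LiesOver v.asIdeal := fun P hP =>
    (IsDedekindDomain.mem_primesOverFinset_iff v.ne_bot B).mp hP
  have hne : ∀ P ∈ s, P ≠ ⊥ := fun P hP =>
    haveI := (hmem P hP).1
    haveI := (hmem P hP).2
    Ideal.ne_bot_of_liesOver_of_ne_bot v.ne_bot P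
  let pt : s → HeightOneSpectrum B := fun P => ⟨P.1, (hmem P.1 P.2).1, hne P.1 P.2⟩
  let W : s → ValuationSubring L := fun P => valuationSubringAtPrime L (pt P)
  have hWinj : Function.Injective W := fun P₁ P₂ h => by
    have := valuationSubringAtPrime_injective (F := L) h
    exact Subtype.ext (congrArg HeightOneSpectrum.asIdeal this)
  refine ⟨s.attach.image W, fun O' => ?_, ?_⟩
  · rw [Finset.mem_image]
    constructor
    · rintro ⟨P, -, rfl⟩
      haveI := (hmem P.1 P.2).2
      exact comap_valuationSubringAtPrime (F := F) (L := L) v (pt P)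
    · intro hO'
      obtain ⟨w, hw, hwO'⟩ := exists_eq_valuationSubringAtPrime (B := B) v O' hO'
      have hws : w.asIdeal ∈ s :=
        (IsDedekindDomain.mem_primesOverFinset_iff v.ne_bot B).mpr ⟨w.isPrime, hw⟩
      exact ⟨⟨w.asIdeal, hws⟩, Finset.mem_attach _ _, hwO'⟩
  · rw [Finset.sum_image fun P₁ _ P₂ _ h => hWinj h]
    have hef : ∀ P : s, ramificationIndex F (W P) * inertiaDegree F (W P) =
        v.asIdeal.ramificationIdx' P.1 * v.asIdeal.inertiaDeg' P.1 := fun P => by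
      haveI := (hmem P.1 P.2).2
      rw [ramificationIndex_valuationSubringAtPrime (F := F) (L := L) v (pt P),
        inertiaDegree_valuationSubringAtPrime (F := F) (L := L) v (pt P)]
    rw [Finset.sum_congr rfl fun P _ => hef P,
      Finset.sum_attach s fun P => v.asIdeal.ramificationIdx' P * v.asIdeal.inertiaDeg' P]
    exact Ideal.sum_ramification_inertia B F L v.ne_bot

end Main

section IntegralClosure

variable {A F L : Type u} [CommRing A] [IsDedekindDomain A] [Field F] [Algebra A F]
  [IsFractionRing A F] [Field L] [Algebra F L] [Algebra A L] [IsScalarTower A F L]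
  [FiniteDimensional F L]

/-- **A Dedekind domain is defectless at `𝔭` in every finite extension in which its integral
closure is finite** (e.g. `L/F` separable, or `A` a finitely generated algebra over a field —
E. Noether): for `𝔭` a non-zero prime of the Dedekind domain `A` with fraction field `F` and
`L/F` finite with `Module.Finite A (integralClosure A L)`, the valued field `(F, A_𝔭)` is
defectless in `L`. [folklore] -/
theorem isDefectlessIn_of_finite_integralClosure (v : HeightOneSpectrum A)
    [hfin : Module.Finite A (integralClosure A L)] :
    IsDefectlessIn F (valuationSubringAtPrime F v) L := by
  haveI : IsFractionRing (integralClosure A L) L :=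
    integralClosure.isFractionRing_of_finite_extension F L
  haveI : IsNoetherianRing (integralClosure A L) :=
    isNoetherian_of_tower A (isNoetherian_of_isNoetherianRing_of_finite A (integralClosure A L))
  haveI : Ring.DimensionLEOne (integralClosure A L) :=
    Ring.DimensionLEOne.of_isIntegral A (integralClosure A L)
  haveI : IsIntegrallyClosed (integralClosure A L) :=
    (isIntegrallyClosed_iff_isIntegrallyClosedIn L).mpr inferInstance
  haveI : IsDedekindDomain (integralClosure A L) := { }
  haveI : Module.IsTorsionFree A L := Module.IsTorsionFree.trans_faithfulSMul A F L
  haveI : Module.IsTorsionFree A (integralClosure A L) :=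
    IsIntegralClosure.isTorsionFree A L
  exact isDefectlessIn_valuationSubringAtPrime (integralClosure A L) v

end IntegralClosure


section Overrings

variable {A F : Type u} [CommRing A] [IsDedekindDomain A] [Field F] [Algebra A F]
  [IsFractionRing A F]

/-- **The valuation rings of `Frac A` containing the Dedekind domain `A` are `Frac A` and the
`A_𝔭`**: a valuation ring `O ∌ F` of `F = Frac A` with `A ⊆ O` is `A_𝔭` for the centre
`𝔭 = 𝔪_O ∩ A`, a non-zero prime. [folklore] -/
theorem exists_eq_valuationSubringAtPrime_of_le (O : ValuationSubring F)
    (hA : ∀ a : A, algebraMap A F a ∈ O) (hO : O ≠ ⊤) :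
    ∃ v : HeightOneSpectrum A, (valuationSubringAtPrime F v) = O := by
  let ι : A →+* O := (algebraMap A F).codRestrict O.toSubring hA
  let P : Ideal A := (maximalIdeal O).comap ι
  haveI hP : P.IsPrime := Ideal.comap_isPrime ι _
  have hmemP : ∀ a : A, a ∈ P ↔ O.valuation (algebraMap A F a) < 1 := fun a => by
    change ι a ∈ maximalIdeal O ↔ _
    rw [ValuationSubring.valuation_lt_one_iff]
    rfl
  -- off the centre, elements of `A` are units of `O`
  have hunit : ∀ a : A, a ∉ P → algebraMap A F a ≠ 0 ∧ (algebraMap A F a)⁻¹ ∈ O := fun a ha => by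
    rw [hmemP, not_lt] at ha
    have h1 : O.valuation (algebraMap A F a) = 1 :=
      le_antisymm ((O.valuation_le_one_iff _).mpr (hA a)) ha
    refine ⟨fun h => ?_, ?_⟩
    · rw [h, map_zero] at h1
      exact zero_ne_one h1
    · rw [← O.valuation_le_one_iff, map_inv₀, h1, inv_one]
  -- the centre is non-zero since `O ≠ F`
  have hP0 : P ≠ ⊥ := by
    intro hP0
    apply hO
    refine eq_top_iff.mpr fun z _ => ?_
    obtain ⟨a, b, hb, rfl⟩ := IsFractionRing.div_surjective (A := A) z
    have hb' : b ∉ P := by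
      rw [hP0, Ideal.mem_bot]
      exact nonZeroDivisors.ne_zero hb
    rw [div_eq_mul_inv]
    exact mul_mem (hA a) (hunit b hb').2
  let v : HeightOneSpectrum A := ⟨P, hP, hP0⟩
  refine ⟨v, ValuationSubring.eq_of_le_of_ne_top _ (fun x hx => ?_) hO⟩
  rw [mem_valuationSubringAtPrime_iff] at hx
  obtain ⟨n, d, hnd⟩ := exists_primeCompl_mul_eq_of_integer v x hx
  obtain ⟨hd0, hdinv⟩ := hunit d d.2
  have hx' : x = algebraMap A F n * (algebraMap A F d)⁻¹ := by
    rw [← hnd, mul_inv_cancel_right₀ hd0]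
  rw [hx']
  exact mul_mem (hA n) hdinv

end Overrings

section FiniteType

variable {k A F : Type u} [Field k] [CommRing A] [IsDedekindDomain A] [Algebra k A]
  [Algebra.FiniteType k A] [Field F] [Algebra A F] [IsFractionRing A F]

include k in
/-- **The local rings of a Dedekind domain of finite type over a field are defectless**: for a
non-zero prime `𝔭` of a Dedekind domain `A` finitely generated over a field `k`, the valued
field `(Frac A, A_𝔭)` is a defectless field — E. Noether's finiteness of the integral closure
(`NoetherFiniteIntegralClosure_holds`) feeds `isDefectlessIn_of_finite_integralClosure` in every
finite extension. [folklore] -/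
theorem isDefectlessField_valuationSubringAtPrime (v : HeightOneSpectrum A) :
    IsDefectlessField F (valuationSubringAtPrime F v) := by
  intro L _ _ hfin
  letI : Algebra A L := ((algebraMap F L).comp (algebraMap A F)).toAlgebra
  haveI : IsScalarTower A F L := IsScalarTower.of_algebraMap_eq fun _ => rfl
  haveI : Module.Finite A (integralClosure A L) := NoetherFiniteIntegralClosure_holds k A F L
  exact isDefectlessIn_of_finite_integralClosure v

include k in
/-- **Every valuation ring of `Frac A` containing a Dedekind domain `A` of finite type over a
field is defectless** (it is `Frac A` itself — trivially valued fields are defectless,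
`isDefectlessField_top` — or some `A_𝔭`). [folklore] -/
theorem isDefectlessField_of_algebraMap_mem (O : ValuationSubring F)
    (hA : ∀ a : A, algebraMap A F a ∈ O) : IsDefectlessField F O := by
  by_cases hO : O = ⊤
  · rw [hO]
    exact isDefectlessField_top F
  · obtain ⟨v, rfl⟩ := exists_eq_valuationSubringAtPrime_of_le O hA hO
    exact isDefectlessField_valuationSubringAtPrime (k := k) v

end FiniteType

section RationalFunctionField

open Polynomial

variable {K F : Type u} [Field K] [Field F] [Algebra K F]

/-- `F = K(x)` with `x` transcendental is the fraction field of `K[X]` (through `X ↦ x`).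
[folklore] -/
theorem isFractionRing_polynomial_of_adjoin_eq_top [Algebra K[X] F] [IsScalarTower K K[X] F]
    (hinj : Function.Injective (algebraMap K[X] F))
    (hgen : IntermediateField.adjoin K {algebraMap K[X] F X} = ⊤) : IsFractionRing K[X] F := by
  set x := algebraMap K[X] F X with hx
  have haeval : ∀ p : K[X], aeval x p = algebraMap K[X] F p := fun p => by
    have h1 : aeval ((IsScalarTower.toAlgHom K K[X] F) X) p =
        IsScalarTower.toAlgHom K K[X] F p := by
      rw [aeval_algHom_apply, aeval_X_left_apply]
    exact h1
  refine (isLocalization_iff (nonZeroDivisors K[X]) F).mpr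
    ⟨fun y => ?_, fun z => ?_, fun {a b} h => ⟨1, by rw [hinj h]⟩⟩
  · exact isUnit_iff_ne_zero.mpr ((map_ne_zero_iff _ hinj).mpr (nonZeroDivisors.ne_zero y.2))
  · have hz : z ∈ IntermediateField.adjoin K {x} := by rw [hgen]; exact IntermediateField.mem_top
    obtain ⟨r, q, rfl⟩ := (IntermediateField.mem_adjoin_simple_iff K _).mp hz
    by_cases hq : aeval x q = 0
    · refine ⟨(0, 1), ?_⟩
      simp [hq]
    · have hq0 : q ≠ 0 := fun h => hq (by rw [h, map_zero])
      refine ⟨(r, ⟨q, mem_nonZeroDivisors_of_ne_zero hq0⟩), ?_⟩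
      simp only [← haeval]
      rw [div_mul_cancel₀ _ hq]

/-- **A rational function field in one variable is defectless under every valuation which is
trivial on the constants.** For `F = K(t)` with `t` transcendental over the field `K` and a
valuation ring `O` of `F` containing `K` (i.e. `O = F`, or the `P`-adic valuation ring for a
monic irreducible `P ∈ K[t]`, or the degree valuation ring `K[1/t]_{(1/t)}`), the valued field
`(F, O)` is a defectless field: every finite extension `L/F` satisfies `∑ᵢ eᵢ fᵢ = [L : F]`.
This is the special case "trivially valued ground field" of the rank-one case (R4) of
Kuhlmann's generalized stability theorem (Kuhlmann 2010, Thm. 1.1 and §5, Lemma 5.4), proved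
here classically: `O` is a local ring of `K[t]` or `K[1/t]`, whose integral closure in `L` is
finite (E. Noether), so that the fundamental equality for Dedekind domains applies.
[cite: Kuhlmann2010, Thm. 1.1 and Section 5, Lemma 5.4 (R4), special case `vK = 0`, `F = K(t)`] -/
theorem isDefectlessField_of_transcendental_of_adjoin_eq_top (O : ValuationSubring F) {t : F}
    (ht : Transcendental K t) (hgen : IntermediateField.adjoin K ({t} : Set F) = ⊤)
    (hK : ∀ c : K, algebraMap K F c ∈ O) : IsDefectlessField F O := by
  -- a generator lying in `O`: `t` or `t⁻¹`
  obtain ⟨s, hsO, hs, hsgen⟩ : ∃ s : F, s ∈ O ∧ Transcendental K s ∧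
      IntermediateField.adjoin K ({s} : Set F) = ⊤ := by
    rcases O.mem_or_inv_mem t with h | h
    · exact ⟨t, h, ht, hgen⟩
    · refine ⟨t⁻¹, h, fun halg => ht ?_, ?_⟩
      · simpa using halg.inv
      · refine eq_top_iff.mpr (hgen.symm.le.trans ?_)
        rw [IntermediateField.adjoin_simple_le_iff]
        simpa using IntermediateField.inv_mem _ (IntermediateField.mem_adjoin_simple_self K t⁻¹)
  letI : Algebra K[X] F := (aeval (R := K) s).toRingHom.toAlgebra
  haveI : IsScalarTower K K[X] F :=
    IsScalarTower.of_algebraMap_eq fun c => (aeval_C s c).symm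
  have hX : algebraMap K[X] F X = s := aeval_X s
  have hinj : Function.Injective (algebraMap K[X] F) :=
    (transcendental_iff_injective (R := K) (x := s)).mp hs
  haveI : IsFractionRing K[X] F :=
    isFractionRing_polynomial_of_adjoin_eq_top hinj (by rw [hX, hsgen])
  refine isDefectlessField_of_algebraMap_mem (k := K) (A := K[X]) O fun p => ?_
  change aeval s p ∈ O
  rw [aeval_eq_sum_range]
  refine sum_mem fun i _ => ?_
  rw [Algebra.smul_def]
  exact mul_mem (hK _) (pow_mem hsO i)

end RationalFunctionField


section ValueTranscendental

open Polynomial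

variable {K F : Type u} [Field K] [Field F] [Algebra K F] (O : ValuationSubring F) {t : F}
  (hvt : ∀ n : ℕ, 0 < n → ∀ c : K, O.valuation t ^ n ≠ O.valuation (algebraMap K F c))

include hvt in
/-- A value-transcendental element is transcendental: in a relation `∑ cᵢ tⁱ = 0` the values
`v(cᵢ tⁱ)`, `cᵢ ≠ 0`, are pairwise distinct, so the sum has the value of one of them and cannot
vanish. [folklore] -/
theorem transcendental_of_valueTranscendental : Transcendental K t := by
  classical
  rintro ⟨p, hp0, hp⟩
  have ht0 : t ≠ 0 := ne_zero_of_valueTranscendental O hvt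
  have hvt0 : O.valuation t ≠ 0 := (_root_.map_ne_zero _).mpr ht0
  have hsum : aeval t p = ∑ n ∈ p.support, algebraMap K F (p.coeff n) * t ^ n := by
    rw [aeval_def, eval₂_eq_sum, Polynomial.sum_def]
  have hinj : Set.InjOn (fun n => O.valuation (algebraMap K F (p.coeff n) * t ^ n))
      p.support := by
    intro i hi j hj hij
    simp only [map_mul, map_pow, Finset.mem_coe, mem_support_iff] at hij hi hj
    by_contra hne
    wlog hlt : i < j generalizing i j
    · exact this hij.symm hj hi (Ne.symm hne) (lt_of_le_of_ne (not_lt.mp hlt) (Ne.symm hne))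
    have hcj : O.valuation (algebraMap K F (p.coeff j)) ≠ 0 :=
      (_root_.map_ne_zero _).mpr ((_root_.map_ne_zero _).mpr hj)
    apply hvt (j - i) (Nat.sub_pos_of_lt hlt) (p.coeff i / p.coeff j)
    rw [map_div₀, map_div₀, eq_div_iff hcj]
    apply mul_left_injective₀ (pow_ne_zero i hvt0)
    simp only
    rw [mul_right_comm, ← pow_add, Nat.sub_add_cancel hlt.le, mul_comm, ← hij]
  obtain ⟨i₀, hi₀, hval, -⟩ :=
    exists_valuation_sum_eq O p.support (Polynomial.support_nonempty.mpr hp0) _ hinj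
  rw [← hsum, hp, map_zero, eq_comm, _root_.map_eq_zero, mul_eq_zero] at hval
  rcases hval with h | h
  · exact (mem_support_iff.mp hi₀) ((_root_.map_eq_zero _).mp h)
  · exact ht0 (pow_eq_zero_iff'.mp h).1

include hvt in
/-- **(R4) of Kuhlmann 2010 for `K(t)` over a TRIVIALLY valued `K`, PROVED**: if `F = K(t)`
with `t` value-transcendental over `K` (for the valuation ring `O = F°`) and `K ⊆ O`, then
`(F, O)` is a defectless field (`isDefectlessField_of_transcendental_of_adjoin_eq_top`; here
`O` is the `t`-adic or the `1/t`-adic valuation ring of `K(t)`). This is the sub-case "`v`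
trivial on `K`" of the rank-one case of `Kuhlmann2010StabilityAlgClosedFiniteRank`
(`GeneralizedStabilityFiniteRank.lean`), for an arbitrary ground field `K`.
[cite: Kuhlmann2010, Thm. 1.1 and Section 5, Lemma 5.4 (R4), special case `vK = 0`, `F = K(t)`] -/
theorem isDefectlessField_of_valueTranscendental_of_comap_eq_top
    (hgen : IntermediateField.adjoin K ({t} : Set F) = ⊤)
    (hK : O.comap (algebraMap K F) = ⊤) : IsDefectlessField F O :=
  isDefectlessField_of_transcendental_of_adjoin_eq_top O
    (transcendental_of_valueTranscendental O hvt) hgen fun c => by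
      change c ∈ O.comap (algebraMap K F)
      rw [hK]
      exact ValuationSubring.mem_top c

end ValueTranscendental

end Literature.AlgebraicGeometry.Resolution
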